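import Summits.FinalStateConjecture.FinalStateConjecture.Theorems.SwallowTheDatumKerrShieldedSettlesStubCollarCauchyAux
import Summits.FinalStateConjecture.FinalStateConjecture.Theorems.KerrShieldedDataExist.Negative.BentHeightSmooth
import Mathlib.Analysis.SpecialFunctions.SmoothTransition
import Mathlib.Analysis.SpecialFunctions.Sqrt
import Literature.Geometry.Lorentzian.KerrSchildCoord
import Literature.Analysis.PDE.WeakBVStrongTraces
import Literature.NumberTheory.Automorphic.RoelckeSelbergBound
import HarnessLib

/-!
# `KerrShieldedSettles`, line `tapered-temporal-collar` — stub S6a, part B: the receding-bend profile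

Scalar ingredients of the hole chart `Ψ₁(s, x⃗) = (holeTime(s, r x⃗), x⃗)`: the **squeeze**
`squeeze τ₀ : ℝ → (τ₀ − 1, ∞)` (smooth, `= id` on `[τ₀, ∞)`), the **near-zone radius**
`nearR u = √u + 1`, the **hole chart time** `holeTime = squeeze + c₀ + T(r)·χ(r / nearR(squeeze) − 2)`
(`T = bentHeight M a`, `χ = Real.smoothTransition`: a Kerr–Schild time translation by `c₀` on the
growing near zone `{r ≤ 2 nearR}`, the full bend beyond `3 nearR` — the STATIONARY bend is refuted,
`Negative/StationaryBendDead`; the receding one is Disproof §C3 / card one-gauge-sliding-seam). Proved: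
near-zone identity, `T(r) ≤ holeTime` for `c₀ = M + 3`, smoothness, and beyond an (inexplicit)
threshold positivity of `∂ₛ holeTime` on the late region, strict monotonicity and surjectivity.
References: Dafermos–Rodnianski arXiv:0811.0354 §5.1; DHRT arXiv:2104.08222 §1.
-/

set_option linter.dupNamespace false

noncomputable section

open Set Filter Topology
open scoped Manifold ContDiff Topology ENNReal
open Literature.Geometry.Lorentzian
open Summit.FinalStateConjecture.FinalStateConjecture.Theorems.KerrShieldedDataExist.Negative
  (bentHeight contDiff_bentHeight)

namespace Summit.FinalStateConjecture.FinalStateConjecture.Theorems.SwallowTheDatum.KerrShieldedSettles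

namespace ExteriorDecomposition

/-! ## The smooth transition: derivative facts (from the Literature)

We use `Literature.Analysis.PDE.deriv_smoothTransition_eq_zero_of_not_mem` (the derivative of
`Real.smoothTransition` vanishes off `(0, 1)`) and
`Literature.NumberTheory.Automorphic.exists_deriv_smoothTransition_bound` (it is bounded). -/

/-! ## The squeeze -/

/-- The **squeeze** `θ : ℝ → (τ₀ − 1, ∞)`: smooth, `θ s = s` for `s ≥ τ₀`
(`θ s = τ₀ − 1 + g(s − τ₀ + 1)` with `g(u) = χ(u)·u + (1 − χ(u))/2`). [folklore] -/
def squeeze (τ₀ s : ℝ) : ℝ :=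
  τ₀ - 1 + (Real.smoothTransition (s - τ₀ + 1) * (s - τ₀ + 1) +
    (1 - Real.smoothTransition (s - τ₀ + 1)) / 2)

/-- On `[τ₀, ∞)` the squeeze is the identity. [folklore] -/
theorem squeeze_eq_self {τ₀ s : ℝ} (hs : τ₀ ≤ s) : squeeze τ₀ s = s := by
  have h1 : Real.smoothTransition (s - τ₀ + 1) = 1 :=
    Real.smoothTransition.one_of_one_le (by linarith)
  rw [squeeze, h1]
  ring

/-- The squeeze stays above `τ₀ − 1`. [folklore] -/
theorem lt_squeeze (τ₀ s : ℝ) : τ₀ - 1 < squeeze τ₀ s := by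
  rw [squeeze]
  set u := s - τ₀ + 1
  have h0 := Real.smoothTransition.nonneg u
  have h1 := Real.smoothTransition.le_one u
  suffices 0 < Real.smoothTransition u * u + (1 - Real.smoothTransition u) / 2 by linarith
  rcases le_or_gt u 0 with hu | hu
  · rw [Real.smoothTransition.zero_of_nonpos hu]
    norm_num
  · have : 0 ≤ Real.smoothTransition u * u := mul_nonneg h0 hu.le
    rcases lt_or_ge u 1 with hu1 | hu1
    · have hlt : Real.smoothTransition u < 1 := Real.smoothTransition.lt_one_of_lt_one hu1
      nlinarith
    · rw [Real.smoothTransition.one_of_one_le hu1]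
      linarith

/-- The squeeze is smooth. [folklore] -/
theorem contDiff_squeeze (τ₀ : ℝ) : ContDiff ℝ ∞ (squeeze τ₀) := by
  have hu : ContDiff ℝ ∞ fun s : ℝ ↦ s - τ₀ + 1 := (contDiff_id.sub contDiff_const).add contDiff_const
  have hχ : ContDiff ℝ ∞ fun s : ℝ ↦ Real.smoothTransition (s - τ₀ + 1) :=
    Real.smoothTransition.contDiff.comp hu
  unfold squeeze
  exact contDiff_const.add ((hχ.mul hu).add ((contDiff_const.sub hχ).div_const _))

/-! ## The near-zone radius -/

/-- The **near-zone radius** `R(u) = √u + 1` (the hole chart's bend starts at `2R`). [folklore] -/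
def nearR (u : ℝ) : ℝ := Real.sqrt u + 1

/-- `1 ≤ R`. [folklore] -/
theorem one_le_nearR (u : ℝ) : 1 ≤ nearR u := by
  rw [nearR]; linarith [Real.sqrt_nonneg u]

/-- `0 < R`. [folklore] -/
theorem nearR_pos (u : ℝ) : 0 < nearR u := lt_of_lt_of_le one_pos (one_le_nearR u)

/-- `R` is monotone. [folklore] -/
theorem nearR_mono : Monotone nearR := fun _ _ h ↦ by
  unfold nearR; linarith [Real.sqrt_le_sqrt h]

/-- `√u < R(u)`. [folklore] -/
theorem sqrt_lt_nearR (u : ℝ) : Real.sqrt u < nearR u := by rw [nearR]; linarith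

/-- `R` is smooth at positive arguments. [folklore] -/
theorem contDiffAt_nearR {u : ℝ} (hu : 0 < u) {n : WithTop ℕ∞} : ContDiffAt ℝ n nearR u :=
  (Real.contDiffAt_sqrt hu.ne').add contDiffAt_const

/-- The derivative of `R` at `u > 0` is `1/(2√u)`. [folklore] -/
theorem hasDerivAt_nearR {u : ℝ} (hu : 0 < u) : HasDerivAt nearR (1 / (2 * Real.sqrt u)) u := by
  have h := (Real.hasDerivAt_sqrt hu.ne').add_const 1
  exact h

/-! ## The hole chart time -/

/-- The **hole chart time** `F(s, r) = θ(s) + c₀ + T(r)·χ(r / R(θ s) − 2)`: a Kerr–Schild time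
translation by `c₀` on the growing near zone `{r ≤ 2R}`, bent by the full graph height beyond `3R`
(Disproof §C3; card one-gauge-sliding-seam). [cite: arXiv210408222, §1] -/
def holeTime (M a τ₀ c₀ s r : ℝ) : ℝ :=
  squeeze τ₀ s + c₀ + bentHeight M a r * Real.smoothTransition (r / nearR (squeeze τ₀ s) - 2)

variable {M a τ₀ c₀ : ℝ}

/-- On the near zone `{r ≤ 2R(θ s)}` the hole chart time is the translation `θ s + c₀`. [folklore] -/
theorem holeTime_of_le_two_mul {s r : ℝ} (hr : r ≤ 2 * nearR (squeeze τ₀ s)) :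
    holeTime M a τ₀ c₀ s r = squeeze τ₀ s + c₀ := by
  have hR := nearR_pos (squeeze τ₀ s)
  have : r / nearR (squeeze τ₀ s) - 2 ≤ 0 := by
    rw [sub_nonpos, div_le_iff₀ hR]; linarith
  rw [holeTime, Real.smoothTransition.zero_of_nonpos this, mul_zero, add_zero]

/-- Late near-zone form: for `s ≥ τ₀` and `r ≤ 2R(s)`, `F(s, r) = s + c₀`. [folklore] -/
theorem holeTime_late_near {s r : ℝ} (hs : τ₀ ≤ s) (hr : r ≤ 2 * nearR s) :
    holeTime M a τ₀ c₀ s r = s + c₀ := by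
  have h := squeeze_eq_self hs
  rw [holeTime_of_le_two_mul (by rwa [h]), h]

/-- Late form: for `s ≥ τ₀`, `F(s, r) = s + c₀ + T(r)·χ(r/R(s) − 2)`. [folklore] -/
theorem holeTime_late {s : ℝ} (hs : τ₀ ≤ s) (r : ℝ) :
    holeTime M a τ₀ c₀ s r = s + c₀ + bentHeight M a r * Real.smoothTransition (r / nearR s - 2) := by
  rw [holeTime, squeeze_eq_self hs]

/-- Two-sided bounds: `θ s + c₀ ≤ F(s, r) ≤ θ s + c₀ + T(r)` (sub-extremal `(M, a)`). [folklore] -/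
theorem holeTime_mem_Icc (ha : |a| < M) (s r : ℝ) :
    holeTime M a τ₀ c₀ s r ∈ Icc (squeeze τ₀ s + c₀) (squeeze τ₀ s + c₀ + bentHeight M a r) := by
  have hT := CollarCauchy.bentHeight_nonneg ha r
  have h0 := Real.smoothTransition.nonneg (r / nearR (squeeze τ₀ s) - 2)
  have h1 := Real.smoothTransition.le_one (r / nearR (squeeze τ₀ s) - 2)
  rw [holeTime]
  constructor
  · nlinarith
  · nlinarith

/-- **All hole-chart values lie above the bent leaf**: `T(r) ≤ F(s, r)` for every `s` and every
`r ≥ 0`, provided `c₀ = M + 3` and `τ₀ ≥ 2` (then `θ s + c₀ ≥ T(3R(θ s)) ≥ (1 − χ)T(r)` by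
`T(ρ) ≤ ρ/2 + M`). [folklore] -/
theorem bentHeight_le_holeTime (ha : |a| < M) (hτ₀ : 2 ≤ τ₀) {s r : ℝ} (hr : 0 ≤ r) :
    bentHeight M a r ≤ holeTime M a τ₀ (M + 3) s r := by
  set θ := squeeze τ₀ s with hθ
  have hθ1 : 1 < θ := by have := lt_squeeze τ₀ s; linarith
  set R := nearR θ with hRdef
  have hR1 : 1 ≤ R := one_le_nearR θ
  have hχ0 := Real.smoothTransition.nonneg (r / R - 2)
  have hχ1 := Real.smoothTransition.le_one (r / R - 2)
  have hT := CollarCauchy.bentHeight_nonneg ha r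
  rw [holeTime]
  change bentHeight M a r ≤ θ + (M + 3) + bentHeight M a r * Real.smoothTransition (r / R - 2)
  rcases le_or_gt r (3 * R) with h3 | h3
  · -- on `r ≤ 3R`: `T(r) ≤ r/2 + M ≤ 1.5 R + M ≤ θ + M + 3` since `R = √θ + 1`
    have hTle : bentHeight M a r ≤ r / 2 + M := CollarCauchy.bentHeight_le_half_add ha hr
    have hsq : Real.sqrt θ ^ 2 = θ := Real.sq_sqrt (by linarith)
    have hRθ : (3 : ℝ) / 2 * R ≤ θ + 3 := by
      rw [hRdef, nearR]; nlinarith [Real.sqrt_nonneg θ, sq_nonneg (Real.sqrt θ - 3 / 4)]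
    nlinarith
  · -- on `r > 3R`: `χ = 1`
    have : Real.smoothTransition (r / R - 2) = 1 := by
      apply Real.smoothTransition.one_of_one_le
      rw [le_sub_iff_add_le, le_div_iff₀ (by linarith)]; linarith
    rw [this, mul_one]
    have : (0 : ℝ) ≤ M := le_trans (abs_nonneg a) ha.le
    linarith

/-! ## The late region: derivative, monotonicity and surjectivity in the chart time -/

/-- On the late region the hole chart time has `s`-derivative
`1 + T(r)·χ′(r/R(s) − 2)·(−r/(2√s R(s)²))`. [folklore] -/
theorem hasDerivAt_holeTime {s : ℝ} (hs : τ₀ < s) (hs0 : 0 < s) (r : ℝ) :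
    HasDerivAt (fun s' ↦ holeTime M a τ₀ c₀ s' r)
      (1 + bentHeight M a r * (deriv Real.smoothTransition (r / nearR s - 2) *
        (r * (-(1 / (2 * Real.sqrt s)) / nearR s ^ 2)))) s := by
  have hR : nearR s ≠ 0 := (nearR_pos s).ne'
  have hξ : HasDerivAt (fun s' ↦ r / nearR s' - 2) (r * (-(1 / (2 * Real.sqrt s)) / nearR s ^ 2)) s := by
    have h1 := ((hasDerivAt_nearR hs0).inv hR).const_mul r
    have h2 := h1.sub_const 2
    refine h2.congr_of_eventuallyEq ?_
    exact Eventually.of_forall fun s' ↦ by simp [div_eq_mul_inv]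
  have hχ : HasDerivAt Real.smoothTransition (deriv Real.smoothTransition (r / nearR s - 2))
      (r / nearR s - 2) :=
    ((Real.smoothTransition.contDiff (n := 1)).contDiffAt.differentiableAt one_ne_zero).hasDerivAt
  have hcomp := hχ.comp s hξ
  have hmain : HasDerivAt (fun s' ↦ s' + c₀ + bentHeight M a r * Real.smoothTransition (r / nearR s' - 2))
      (1 + bentHeight M a r * (deriv Real.smoothTransition (r / nearR s - 2) *
        (r * (-(1 / (2 * Real.sqrt s)) / nearR s ^ 2)))) s := by
    exact ((hasDerivAt_id s).add_const c₀).add (hcomp.const_mul (bentHeight M a r))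
  refine hmain.congr_of_eventuallyEq ?_
  filter_upwards [Ioi_mem_nhds hs] with s' hs'
  exact holeTime_late hs'.le r

/-- The correction term of `∂ₛ holeTime` is smaller than `1` once `R(s) = √s + 1` exceeds the
threshold `9C + 12CM + 2` (`C` a bound for `χ′`): it vanishes unless `2R < r < 3R`, where
`T(r)·r ≤ (1.5R + M)·3R` and `2√s R² ≥ R³`. [folklore] -/
theorem abs_correction_lt_one (ha : |a| < M) {C : ℝ} (hC0 : 0 ≤ C)
    (hC : ∀ x, |deriv Real.smoothTransition x| ≤ C) {s r : ℝ} (hs : 1 ≤ s) (hr : 0 ≤ r)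
    (hK : 9 * C + 12 * C * M + 2 ≤ nearR s) :
    |bentHeight M a r * (deriv Real.smoothTransition (r / nearR s - 2) *
        (r * (-(1 / (2 * Real.sqrt s)) / nearR s ^ 2)))| < 1 := by
  set R := nearR s with hRdef
  have hM : 0 < M := lt_of_le_of_lt (abs_nonneg a) ha
  have hR2 : 2 ≤ R := by nlinarith
  have hRpos : 0 < R := by linarith
  have hsq : Real.sqrt s = R - 1 := by rw [hRdef, nearR]; ring
  have hsqpos : 0 < Real.sqrt s := by rw [hsq]; linarith
  by_cases hξ : r / R - 2 ∈ Ioo (0 : ℝ) 1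
  · -- the transition zone `2R < r < 3R`
    obtain ⟨hξ0, hξ1⟩ := hξ
    have hr2 : 2 * R < r := by
      have := (lt_div_iff₀ hRpos).1 (by linarith : (2 : ℝ) < r / R); linarith
    have hr3 : r < 3 * R := by
      have := (div_lt_iff₀ hRpos).1 (by linarith : r / R < 3); linarith
    have hT0 := CollarCauchy.bentHeight_nonneg ha r
    have hTle : bentHeight M a r ≤ r / 2 + M := CollarCauchy.bentHeight_le_half_add ha hr
    have hχ := hC (r / R - 2)
    -- `|T χ′ r/(2√s R²)| ≤ (1.5R + M) C 3R / (2 (R-1) R²)` and `R - 1 ≥ R/2`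
    have hden : 0 < 2 * Real.sqrt s * R ^ 2 := by positivity
    have key : |bentHeight M a r * (deriv Real.smoothTransition (r / R - 2) *
        (r * (-(1 / (2 * Real.sqrt s)) / R ^ 2)))| =
        bentHeight M a r * |deriv Real.smoothTransition (r / R - 2)| * r / (2 * Real.sqrt s * R ^ 2) := by
      rw [abs_mul, abs_mul, abs_of_nonneg hT0]
      have : |r * (-(1 / (2 * Real.sqrt s)) / R ^ 2)| = r / (2 * Real.sqrt s * R ^ 2) := by
        have hle : r * (-(1 / (2 * Real.sqrt s)) / R ^ 2) ≤ 0 :=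
          mul_nonpos_of_nonneg_of_nonpos hr
            (div_nonpos_of_nonpos_of_nonneg (neg_nonpos.2 (by positivity)) (by positivity))
        rw [abs_of_nonpos hle]
        field_simp
      rw [this]
      field_simp
    rw [key, div_lt_one hden, hsq]
    have h1 : bentHeight M a r * |deriv Real.smoothTransition (r / R - 2)| * r ≤
        (3 / 2 * R + M) * C * (3 * R) := by
      have hA : bentHeight M a r ≤ 3 / 2 * R + M := by linarith
      have hB : |deriv Real.smoothTransition (r / R - 2)| ≤ C := hχ
      calc bentHeight M a r * |deriv Real.smoothTransition (r / R - 2)| * r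
          ≤ (3 / 2 * R + M) * C * r := by gcongr
        _ ≤ (3 / 2 * R + M) * C * (3 * R) := by gcongr
    -- `(1.5R + M)·C·3R < 2(R − 1)R²` from `R ≥ 9C + 12CM + 2`
    nlinarith [mul_nonneg hC0 hM.le, sq_nonneg R]
  · rw [hRdef] at hξ
    rw [Literature.Analysis.PDE.deriv_smoothTransition_eq_zero_of_not_mem hξ]
    simp

/-- **Threshold for the hole chart.** There is `τ₁ ≥ 2` such that for every `τ₀ ≥ τ₁`, every `r ≥ 0`
and every `s > τ₀`, the `s`-derivative of the hole chart time is positive. [folklore] -/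
theorem exists_threshold (ha : |a| < M) :
    ∃ τ₁ : ℝ, 2 ≤ τ₁ ∧ ∀ τ₀ c₀ : ℝ, τ₁ ≤ τ₀ → ∀ r : ℝ, 0 ≤ r → ∀ s : ℝ, τ₀ < s →
      0 < 1 + bentHeight M a r * (deriv Real.smoothTransition (r / nearR s - 2) *
        (r * (-(1 / (2 * Real.sqrt s)) / nearR s ^ 2))) := by
  obtain ⟨C, hC0, hC⟩ := Literature.NumberTheory.Automorphic.exists_deriv_smoothTransition_bound
  set K : ℝ := 9 * C + 12 * C * M + 2
  have hM : 0 < M := lt_of_le_of_lt (abs_nonneg a) ha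
  have hK0 : 0 ≤ K := by positivity
  refine ⟨max 2 (K ^ 2), le_max_left _ _, fun τ₀ c₀ hτ r hr s hs ↦ ?_⟩
  have hs1 : 1 ≤ s := by linarith [le_max_left 2 (K ^ 2)]
  have hKs : K ≤ nearR s := by
    have : K ≤ Real.sqrt s := by
      rw [show K = Real.sqrt (K ^ 2) from (Real.sqrt_sq hK0).symm]
      exact Real.sqrt_le_sqrt (by linarith [le_max_right 2 (K ^ 2)])
    rw [nearR]; linarith
  have h := abs_correction_lt_one ha hC0 hC hs1 hr hKs
  have := neg_lt_of_abs_lt h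
  linarith

/-- The hole chart time is continuous in `s` on the late region `[τ₀, ∞)`. [folklore] -/
theorem continuousOn_holeTime (r : ℝ) :
    ContinuousOn (fun s ↦ holeTime M a τ₀ c₀ s r) (Ici τ₀) := by
  have h : ContinuousOn (fun s ↦ s + c₀ + bentHeight M a r * Real.smoothTransition (r / nearR s - 2))
      (Ici τ₀) := by
    apply Continuous.continuousOn
    have hR : Continuous nearR := (Real.continuous_sqrt.add continuous_const)
    have hne : ∀ s, nearR s ≠ 0 := fun s ↦ (nearR_pos s).ne'
    exact (continuous_id.add continuous_const).add (continuous_const.mul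
      (Real.smoothTransition.continuous.comp ((continuous_const.div hR hne).sub continuous_const)))
  exact h.congr fun s hs ↦ holeTime_late hs r

/-- **Strict monotonicity in the chart time** on the late region, beyond the threshold. [folklore] -/
theorem strictMonoOn_holeTime (hτ₀ : 0 < τ₀) {r : ℝ}
    (hpos : ∀ s : ℝ, τ₀ < s → 0 < 1 + bentHeight M a r * (deriv Real.smoothTransition (r / nearR s - 2) *
        (r * (-(1 / (2 * Real.sqrt s)) / nearR s ^ 2)))) :
    StrictMonoOn (fun s ↦ holeTime M a τ₀ c₀ s r) (Ici τ₀) := by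
  refine strictMonoOn_of_deriv_pos (convex_Ici τ₀) (continuousOn_holeTime r) fun s hs ↦ ?_
  rw [interior_Ici] at hs
  rw [(hasDerivAt_holeTime hs (hτ₀.trans hs) r).deriv]
  exact hpos s hs

/-- **Surjectivity onto late times**: every `t ≥ F(τ₀, r)` is `F(s, r)` for some `s ≥ τ₀`
(`F(s, r) ≥ s + c₀`, intermediate value theorem; `c₀ ≥ 0`). [folklore] -/
theorem exists_holeTime_eq (ha : |a| < M) (hc₀ : 0 ≤ c₀) {r t : ℝ}
    (ht : holeTime M a τ₀ c₀ τ₀ r ≤ t) : ∃ s, τ₀ ≤ s ∧ holeTime M a τ₀ c₀ s r = t := by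
  set b := max τ₀ t with hb
  have hτb : τ₀ ≤ b := le_max_left _ _
  have hFb : t ≤ holeTime M a τ₀ c₀ b r := by
    have h1 := (holeTime_mem_Icc (τ₀ := τ₀) (c₀ := c₀) ha b r).1
    rw [squeeze_eq_self hτb] at h1
    linarith [le_max_right τ₀ t]
  have hcont : ContinuousOn (fun s ↦ holeTime M a τ₀ c₀ s r) (Icc τ₀ b) :=
    (continuousOn_holeTime r).mono Icc_subset_Ici_self
  obtain ⟨s, hs, hst⟩ := intermediate_value_Icc hτb hcont ⟨ht, hFb⟩
  exact ⟨s, hs.1, hst⟩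

/-! ## Smoothness on the chart -/

/-- The hole chart time, read on `E4` as `x ↦ F(x⁰, r(x))`, is `C^∞` wherever `r > 0`
(`τ₀ ≥ 1`, sub-extremal `(M, a)`). [folklore] -/
theorem contDiffAt_holeTime_radius (ha : |a| < M) (hτ₀ : 1 ≤ τ₀) {x : E4} (hx : 0 < Kerr.radius a x) :
    ContDiffAt ℝ ∞ (fun y : E4 ↦ holeTime M a τ₀ c₀ (y 0) (Kerr.radius a y)) x := by
  have h0 : ContDiffAt ℝ ∞ (fun y : E4 ↦ y 0) x := (contDiff_euclidean.1 contDiff_id 0).contDiffAt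
  have hθ : ContDiffAt ℝ ∞ (fun y : E4 ↦ squeeze τ₀ (y 0)) x :=
    (contDiff_squeeze τ₀).contDiffAt.comp x h0
  have hθpos : 0 < squeeze τ₀ (x 0) := by have := lt_squeeze τ₀ (x 0); linarith
  have hR0 : ContDiffAt ℝ ∞ (nearR ∘ fun y : E4 ↦ squeeze τ₀ (y 0)) x :=
    (contDiffAt_nearR hθpos).comp x hθ
  have hR : ContDiffAt ℝ ∞ (fun y : E4 ↦ nearR (squeeze τ₀ (y 0))) x := hR0
  have hr : ContDiffAt ℝ ∞ (Kerr.radius a) x := Kerr.contDiffAt_radius hx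
  have hT : ContDiffAt ℝ ∞ (fun y : E4 ↦ bentHeight M a (Kerr.radius a y)) x :=
    (contDiff_bentHeight ha).contDiffAt.comp x hr
  have hξ : ContDiffAt ℝ ∞ (fun y : E4 ↦ Kerr.radius a y / nearR (squeeze τ₀ (y 0)) - 2) x :=
    (hr.div hR (nearR_pos _).ne').sub contDiffAt_const
  have hχ : ContDiffAt ℝ ∞
      (fun y : E4 ↦ Real.smoothTransition (Kerr.radius a y / nearR (squeeze τ₀ (y 0)) - 2)) x :=
    Real.smoothTransition.contDiff.contDiffAt.comp x hξ
  unfold holeTime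
  exact (hθ.add contDiffAt_const).add (hT.mul hχ)


/-- **Registered helper stub** (S6a part B): the squeeze stays above `τ₀ − 1` (the content of
`lt_squeeze`, unfolded). [folklore] -/
theorem _root_.Summit.FinalStateConjecture.FinalStateConjecture.Theorems.SwallowTheDatum.KerrShieldedSettles.stub_kerrExteriorDecompositionProfile :
    ∀ (τ₀ s : ℝ), τ₀ - 1 < τ₀ - 1 + (Real.smoothTransition (s - τ₀ + 1) * (s - τ₀ + 1) +
      (1 - Real.smoothTransition (s - τ₀ + 1)) / 2) :=
  fun τ₀ s ↦ lt_squeeze τ₀ s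

end ExteriorDecomposition

end Summit.FinalStateConjecture.FinalStateConjecture.Theorems.SwallowTheDatum.KerrShieldedSettles

end
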